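import Literature.NumberTheory.Transcendental.PkappaThetaCosetHilbert
import Literature.NumberTheory.Transcendental.ThetaLinealityStructure
import HarnessLib

/-!
# Pure theta forms: transport from the model without torus and vector factors

Topic: `Literature/NumberTheory/Transcendental`. A brick of the discharge of the named fact
`Literature.NumberTheory.Transcendental.philippon1986_std` (classification of the obstruction
subgroups of Philippon's zero estimate on `M_κ = 𝔾ₘ^β × P_κ`, general number of elliptic factors).
The PURE theta forms — polynomials in the `Θ_{(none,(M,none))} = ∏_b P_{M_b}(z'_b)` only — are the
theta polynomial ring of the model with EMPTY torus and fibre (`β = δ = ∅`), read in the full ring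
through `rename pureIdx`:

* `thetaEval_pureRename` — `F_{ρ P}(w) = F_P(z'(w))`: pure forms only see the `E`-coordinates;
* `pureData C` — the algebraic subgroup datum `(⊤, C, ⊤)` of the empty model, whose Lie algebra is
  the complex solution space `TZ` of the rational system `C`;
* `exists_linearIndependent_pure` — for every rational system `C ≤ ℚ^γ` and degree `t` there are
  `binom(t + m, m)` PURE forms of degree `t`, `m = dim_ℂ TZ`, whose restrictions to
  `(0, TZ, 0) ⊆ Lie M_κ` are linearly independent (transport of
  `exists_linearIndependent_thetaEval_coset` for `pureData C` at the origin).

Everything is PROVED; the only definitions are `κ₀`, `pureIdx`, `zOnly`, `pureData`.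

## References

* Yu. V. Nesterenko, P. Philippon (eds.), *Introduction to Algebraic Independence Theory*,
  LNM 1752, Springer 2001, Ch. 11 (D. Roy), Prop. 2.3. [NesterenkoPhilippon2001]
-/

noncomputable section

open Complex MvPolynomial Module
open scoped PeriodPair

namespace Literature.NumberTheory.Transcendental

namespace GaGmE

namespace Std

variable {β γ δ : Type} [Fintype β] [Fintype γ] [Fintype δ] [DecidableEq γ]
variable (L : PeriodPair) (κM : δ → γ → Kbar)

/-! ### The empty model and the renaming -/

/-- The (empty) matrix `κ` of the model without fibre. [folklore] -/
def κ₀ : Empty → γ → Kbar := fun e => e.elim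

/-- The renaming of the pure indices into the full index set. [folklore] -/
def pureIdx : Option Empty × ThetaIdx γ Empty → Option β × ThetaIdx γ δ := fun J => (none, (J.2.1, none))

/-- A vector of the empty model with given `E`-coordinates. [folklore] -/
def zOnly (z : γ → ℂ) : Empty ⊕ (γ ⊕ Empty) → ℂ := coords Empty.elim z Empty.elim

omit [Fintype β] [Fintype γ] [Fintype δ] [DecidableEq γ] in
/-- The `E`-coordinates of `zOnly z`. [folklore] -/
@[simp] theorem zOnly_iz (z : γ → ℂ) (b : γ) : zOnly z (iz b) = z b := rfl

omit [Fintype β] [Fintype γ] [Fintype δ] [DecidableEq γ] in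
/-- Every vector of the empty model is `zOnly` of its `E`-coordinates. [folklore] -/
theorem zOnly_zPart (w : Empty ⊕ (γ ⊕ Empty) → ℂ) : zOnly (zPart w) = w := by
  funext k; rcases k with j | b | e
  · exact j.elim
  · rfl
  · exact e.elim

omit [Fintype β] [Fintype δ] in
/-- **Pure theta functions only see `z'`.** [folklore] -/
theorem theta_pureIdx (J : Option Empty × ThetaIdx γ Empty) (w : β ⊕ (γ ⊕ δ) → ℂ) :
    theta L κM (pureIdx J) w = theta L κ₀ J (zOnly (zPart w)) := by
  obtain ⟨o, M, o'⟩ := J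
  rcases o with _ | j
  · rcases o' with _ | e
    · simp [pureIdx, theta, thetaPnone, zPart]
    · exact e.elim
  · exact j.elim

omit [Fintype β] [Fintype δ] in
/-- **`F_{ρP}(w) = F_P(z'(w))`** for pure forms. [folklore] -/
theorem thetaEval_pureRename (P : MvPolynomial (Option Empty × ThetaIdx γ Empty) ℂ) (w : β ⊕ (γ ⊕ δ) → ℂ) :
    thetaEval L κM (rename pureIdx P) w = thetaEval L κ₀ P (zOnly (zPart w)) := by
  simp only [thetaEval, eval_rename]
  congr 2
  funext J
  exact theta_pureIdx L κM J w

omit [Fintype β] [Fintype δ] in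
/-- Pure forms only depend on the `E`-coordinates. [folklore] -/
theorem thetaEval_pureRename_eq_of_zPart_eq (P : MvPolynomial (Option Empty × ThetaIdx γ Empty) ℂ)
    {w w' : β ⊕ (γ ⊕ δ) → ℂ} (h : zPart w = zPart w') :
    thetaEval L κM (rename pureIdx P) w = thetaEval L κM (rename pureIdx P) w' := by
  rw [thetaEval_pureRename, thetaEval_pureRename, h]

omit [Fintype β] [Fintype δ] in
/-- Pure forms at `w` and at `(0, z'(w), 0)`. [folklore] -/
theorem thetaEval_pureRename_zEmb (P : MvPolynomial (Option Empty × ThetaIdx γ Empty) ℂ) (w : β ⊕ (γ ⊕ δ) → ℂ) :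
    thetaEval L κM (rename pureIdx P) w = thetaEval L κM (rename pureIdx P) (coords (0 : β → ℂ) (zPart w) (0 : δ → ℂ)) :=
  thetaEval_pureRename_eq_of_zPart_eq L κM P (by funext b; simp [zPart])

/-! ### The datum `(⊤, C, ⊤)` of the empty model -/

/-- The algebraic subgroup datum of the empty model with abelian relations `C`. [folklore] -/
def pureData (C : Submodule ℚ (γ → ℚ)) : SubgroupDataC Empty γ Empty (κ₀ (γ := γ)) where
  A := ⊤
  C := C
  Ξ := ⊤
  compat ξ _ := by
    have : (fun b => ∑ e, ξ e * (κ₀ (γ := γ) e b : ℂ)) = 0 := by funext b; simp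
    rw [this]; exact Submodule.zero_mem _

omit [Fintype β] [Fintype δ] [DecidableEq γ] in
/-- Membership in the Lie algebra of `pureData C`. [folklore] -/
theorem mem_tangent_pureData_iff (C : Submodule ℚ (γ → ℚ)) (w : Empty ⊕ (γ ⊕ Empty) → ℂ) :
    w ∈ (pureData C).tangent ↔ ∀ c ∈ C, ∑ b, (c b : ℂ) * w (iz b) = 0 := by
  rw [SubgroupDataC.mem_tangent_iff]
  simp [pureData]

omit [Fintype β] [Fintype δ] [DecidableEq γ] in
/-- `zOnly z ∈ Lie(pureData C)` iff `z ∈ TZ`. [folklore] -/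
theorem zOnly_mem_tangent_iff (C : Submodule ℚ (γ → ℚ)) (z : γ → ℂ) :
    zOnly z ∈ (pureData C).tangent ↔ z ∈ (pureData C).TZ := by
  rw [mem_tangent_pureData_iff, SubgroupDataC.mem_TZ_iff]
  rfl

omit [Fintype β] [Fintype δ] [DecidableEq γ] in
/-- `dim Lie(pureData C) = dim TZ`. [folklore] -/
theorem finrank_tangent_pureData (C : Submodule ℚ (γ → ℚ)) :
    finrank ℂ (pureData C).tangent = finrank ℂ (pureData C).TZ := by
  rw [SubgroupDataC.finrank_tangent]
  have h1 : finrank ℂ (pureData C).TY = 0 := by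
    apply finrank_zero_of_subsingleton
  have h2 : finrank ℂ (pureData C).TS = 0 := by
    apply finrank_zero_of_subsingleton
  omega

/-! ### Independent pure forms -/

omit [Fintype β] [Fintype δ] in
/-- **Independent pure forms on a rational subspace of the abelian directions.** For a rational
system `C ≤ ℚ^γ` with complex solution space `TZ` of dimension `m` and every `t`, there are
`binom(t + m, m)` pure forms of degree `t` whose values at `(0, z, 0)`, `z ∈ TZ`, are linearly
independent functions of `z`. [cite: NesterenkoPhilippon2001, Ch. 11 Prop. 2.3] -/
theorem exists_linearIndependent_pure (C : Submodule ℚ (γ → ℚ)) (t : ℕ) :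
    ∃ (n : ℕ) (P : Fin n → MvPolynomial (Option Empty × ThetaIdx γ Empty) ℂ),
      n = (t + finrank ℂ (pureData C).TZ).choose (finrank ℂ (pureData C).TZ) ∧
      (∀ k, (rename (pureIdx (β := β) (δ := δ)) (P k)).IsHomogeneous t) ∧
      LinearIndependent ℂ fun k => fun z : (pureData C).TZ =>
        thetaEval L κM (rename (pureIdx (β := β) (δ := δ)) (P k)) (coords (0 : β → ℂ) (z : γ → ℂ) (0 : δ → ℂ)) := by
  classical
  obtain ⟨n, P, hn, hhom, hli⟩ := exists_linearIndependent_thetaEval_coset L (pureData C) 0 t (κM := κ₀)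
  refine ⟨n, P, by rw [hn, finrank_tangent_pureData], fun k => (hhom k).rename_isHomogeneous, ?_⟩
  rw [linearIndependent_iff'] at hli ⊢
  intro s c hc k hk
  refine hli s c ?_ k hk
  funext w
  have hw : zPart (w : Empty ⊕ (γ ⊕ Empty) → ℂ) ∈ (pureData C).TZ := by
    rw [← zOnly_mem_tangent_iff, zOnly_zPart]; exact w.2
  have := congr_fun hc ⟨zPart (w : Empty ⊕ (γ ⊕ Empty) → ℂ), hw⟩
  simp only [Finset.sum_apply, Pi.smul_apply, smul_eq_mul, Pi.zero_apply] at this ⊢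
  rw [← this]
  refine Finset.sum_congr rfl fun k' _ => ?_
  congr 1
  rw [zero_add, thetaEval_pureRename]
  congr 1
  rw [← zOnly_zPart (w : Empty ⊕ (γ ⊕ Empty) → ℂ)]
  congr 1

end Std

end GaGmE

end Literature.NumberTheory.Transcendental

end
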